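import Mathlib
import HarnessLib
import Summits.HubbardSuperconductivity.HubbardSuperconductivity.Theorems.KLProgrammeC4aJointCurvaturePartnerBand
import Summits.HubbardSuperconductivity.HubbardSuperconductivity.Theorems.KLProgrammeC4aCausticWindowDispatch

/-!
# Route `KLProgramme` — crux C4a, S3 brick (B4) «(B4)-UMK1», the (M4)-facing CAPSTONE of «(M2)-DISPATCH» + «(M2)-HESSIAN»: the ϑ-layer of the umklapp first-order jet on a
# FIXED window near an antipodal-umklapp configuration is ONE CALL — `FrameOK` + window geometry + the two first-order laws keyed to the SIGN of the caustic offset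
# ⟹ `∫_α^β F ≤ (8A + 4P)/√(κ₀/2) + B(β − α) + ∫R`, `κ₀ = (9/400)u_min² − 2ε(Δ, |ρ|, ω)`

Cell `gate-hubbard-kl`, seat hubbard-kl-k3c3-p3 (g29; row «implicit-function / monotonicity route for μ(n)»).  Located brick for the (C)-closer lane hubbard-kl-c4a-1
(stub (C) `stub_twoLeg_curvature` of `KLRegimeEngineV17F2`, stmt-HubbardSuperconductivity-20437), memo HOME/hubbard-kl-k3c3-p3/U1-CAUSTIC-SUP.md §7 (M2)/(M4).
Composition of three landed pieces, nothing new analytically: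
(i) `…C4aJointCurvaturePartnerBand.convexOn_partnerBand_antipodal_sub_sq` (joint strong convexity of `(ϑ,φ) ↦ e_K(c + Φ(ρ,ϑ+θ) − Φ(0,φ+θ))` in `ϑ` on the box,
modulus `κ₀`); (ii) partial minimisation in `φ` (here `convexOn_min_sub_sq_of_exists`: the caustic offset `m ϑ` = a minimum of the family over the `φ`-window ATTAINED in the
window — stated with `∃`, no selection function); (iii) `…C4aCausticWindowDispatch.intervalIntegral_caustic_dispatch_remainder_le` (sign pair internal).
* §1 `convexOn_min_sub_sq_of_exists` (twin of `convexOn_partialMin_sub_sq` with an existential minimiser);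
* §2 `intervalIntegral_caustic_dispatch_partnerBand_sInf_le`: the same with the canonical offset `inf_{φ ∈ [φa,φb]}` — its continuity, attainment and minimality discharged;
* §2 **`intervalIntegral_caustic_dispatch_partnerBand_le`**: `|ρ| < r`, base point `c` (`= Φ(0,θ) − 2πm` for the umklapp sheet `m`), base angle `θ`, reference Fermi angle `ψ`;
  ϑ-window `[α,β]`, φ-window `[φa,φb]`; on the box: `‖c + Φ(ρ,ϑ+θ) − Φ(0,φ+θ) − Φ(0,ψ)‖ ≤ Δ`, `|ϑ+θ−(ψ+π)| ≤ ω`, `|φ+θ−ψ| ≤ ω`; budget `2ε < (9/400)u_min²`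
  (`ε = 2K₃ΔD₁² + 4K₂δD₁ + K₂ΔD₂ + K₁η`, `δ = RR₁|ρ| + D₂ω`, `η = C₂row|ρ| + D₃ω`); an offset `m` continuous on `[α,β]` which is, at each `ϑ`, the minimum of
  `φ ↦ e_K(c + Φ(ρ,ϑ+θ) − Φ(0,φ+θ))` over `[φa,φb]` attained there; `F ≥ 0`, `R ≥ 0` integrable, the one-sided pre-caustic law WHERE `m ϑ > 0` and the log-free
  post-caustic law WHERE `m ϑ < 0` ⟹ `∫_α^β F ≤ (8A + 4P)/√(κ₀/2) + B(β − α) + ∫_α^β R`.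
Hypotheses = those of `…C4aFoldCurvaturePartnerBand` §2.  Bookkeeping on landed objects; nothing asserts (C), K3 or superconductivity.
References: FST II CPAM 51 (1998) §3 [cite: FeldmanSalmhoferTrubowitz1998]; Salmhofer 1999 §4.5.3 [cite: Salmhofer1999].
-/

noncomputable section

namespace Summit.HubbardSuperconductivity.HubbardSuperconductivity.Theorems.C4a

set_option linter.dupNamespace false -- summit = problem name (single-conjunct summit), D-0017
set_option maxSynthPendingDepth 3 -- nested operator-norm instances (third Fréchet derivatives)

open Real Set Filter MeasureTheory intervalIntegral
open scoped Topology
open Literature.MathematicalPhysics.QuantumLattice Literature.MathematicalPhysics.QuantumLattice.BandSectorCounting Literature.Probability.LatticeModels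
open Summit.HubbardSuperconductivity.HubbardSuperconductivity.Theorems.KLRegimeSplit
open Summit.HubbardSuperconductivity.HubbardSuperconductivity.Theorems.DispersionFlow
open Summit.HubbardSuperconductivity.HubbardSuperconductivity.Theorems.PerturbedFermiCurve

/-! ## §1 Partial minimisation with an existential minimiser -/

/-- **THE ATTAINED MINIMUM INHERITS THE MODULUS** (twin of `convexOn_partialMin_sub_sq`, no selection function): `(ϑ,φ) ↦ g ϑ φ − (κ/2)ϑ²` convex on `I ×ˢ W`,
`I, W` convex, and for `ϑ ∈ I` the value `m ϑ` is `≤ g ϑ φ` for all `φ ∈ W` and `= g ϑ φ*` for some `φ* ∈ W`.  THEN `ϑ ↦ m ϑ − (κ/2)ϑ²` is convex on `I`. -/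
theorem convexOn_min_sub_sq_of_exists {g : ℝ → ℝ → ℝ} {m : ℝ → ℝ} {I W : Set ℝ} {κ : ℝ}
    (hg : ConvexOn ℝ (I ×ˢ W) (fun p : ℝ × ℝ => g p.1 p.2 - κ / 2 * p.1 ^ 2)) (hI : Convex ℝ I) (hW : Convex ℝ W)
    (hle : ∀ ϑ ∈ I, ∀ φ ∈ W, m ϑ ≤ g ϑ φ) (hex : ∀ ϑ ∈ I, ∃ φ ∈ W, m ϑ = g ϑ φ) :
    ConvexOn ℝ I (fun ϑ => m ϑ - κ / 2 * ϑ ^ 2) := by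
  refine ⟨hI, fun x hx y hy a b ha hb hab => ?_⟩
  obtain ⟨φx, hφx, hmx⟩ := hex x hx
  obtain ⟨φy, hφy, hmy⟩ := hex y hy
  have hφ : a * φx + b * φy ∈ W := by simpa [smul_eq_mul] using hW hφx hφy ha hb hab
  have hϑ : a * x + b * y ∈ I := by simpa [smul_eq_mul] using hI hx hy ha hb hab
  have hj := hg.2 (mk_mem_prod hx hφx) (mk_mem_prod hy hφy) ha hb hab
  simp only [Prod.smul_mk, Prod.mk_add_mk, smul_eq_mul] at hj
  have hm := hle (a * x + b * y) hϑ (a * φx + b * φy) hφ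
  simp only [smul_eq_mul]
  rw [hmx, hmy]
  linarith

/-! ## §2 The capstone: the ϑ-layer near an antipodal-umklapp configuration in one call -/

section Sizes

variable {K : TrigPolyC4v} {A : ℝ} (hA : ∀ p : Momentum, ∀ j ≤ 2, ‖iteratedFDeriv ℝ j (frameShift K) p‖ ≤ A) (hA20 : A ≤ 1 / 20)
  (hd : klCurveD ≤ (bandBounds (show (-4 : ℝ) < -1.1 by norm_num) (show (-1.1 : ℝ) ≤ -0.1 by norm_num)
    (show (-0.1 : ℝ) < 0 by norm_num)).Dtmin - 2 * A)
  {μ r : ℝ} (hr : 0 < r) (hlo : (-1.1 : ℝ) < μ - r - A) (hhi : μ + r + A < -0.1)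
  {A₃ A₄ : ℝ} (hA₃ : ∀ p : Momentum, ‖iteratedFDeriv ℝ 3 (frameShift K) p‖ ≤ A₃)
  (hA₄ : ∀ p : Momentum, ‖iteratedFDeriv ℝ 4 (frameShift K) p‖ ≤ A₄)
  {K₁ K₂ K₃ : ℝ} (hK₁ : ∀ p : Momentum, ‖fderiv ℝ (frameLevel μ K) p‖ ≤ K₁) (hK₂ : ∀ p : Momentum, ‖iteratedFDeriv ℝ 2 (frameLevel μ K) p‖ ≤ K₂)
  (hK₃ : ∀ p : Momentum, ‖iteratedFDeriv ℝ 3 (frameLevel μ K) p‖ ≤ K₃)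
include hA hA20 hd hr hlo hhi hA₃ hA₄ hK₁ hK₂ hK₃

/-- **THE ϑ-LAYER OF THE UMKLAPP FIRST-ORDER JET NEAR AN ANTIPODAL-UMKLAPP CONFIGURATION, IN ONE CALL.**  Window budget
`ε = 2K₃ΔD₁² + 4K₂δD₁ + K₂ΔD₂ + K₁η` (`δ = RR₁|ρ| + D₂ω`, `η = C₂row|ρ| + D₃ω`, `D_j = msD A₃ A₄ j`, `d = Dt_min − 2A`) with `2ε < (9/400)u_min²`, `κ₀ = (9/400)u_min² − 2ε`;
the caustic offset `m` is the minimum over the `φ`-window, attained, continuous in `ϑ`; laws routed by its sign.  THEN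
`∫_α^β F ≤ (8A′ + 4P)/√(κ₀/2) + B(β − α) + ∫_α^β R`. -/
theorem intervalIntegral_caustic_dispatch_partnerBand_le {R : RenConsts} {U : ℝ} {N : ℕ} (hF : FrameOK R U N μ K) {ρ : ℝ} (hρ : |ρ| < r)
    (c : Momentum) (θ ψ : ℝ) {α β φa φb : ℝ} (hαβ : α ≤ β) {Δ ω : ℝ}
    (hΔ : ∀ x ∈ Icc α β ×ˢ Icc φa φb, ‖c + (levelPoint μ K ρ (x.1 + θ) - levelPoint μ K 0 (x.2 + θ)) - levelPoint μ K 0 ψ‖ ≤ Δ)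
    (hω₁ : ∀ ϑ ∈ Icc α β, |ϑ + θ - (ψ + π)| ≤ ω) (hω₂ : ∀ φ ∈ Icc φa φb, |φ + θ - ψ| ≤ ω)
    (hbudget : 2 * (2 * K₃ * Δ * msD A₃ A₄ 1 ^ 2 +
        4 * K₂ * (radialRowOneConst A ((bandBounds (show (-4 : ℝ) < -1.1 by norm_num) (show (-1.1 : ℝ) ≤ -0.1 by norm_num) (show (-0.1 : ℝ) < 0 by norm_num)).Dtmin - 2 * A) * |ρ| +
          msD A₃ A₄ 2 * ω) * msD A₃ A₄ 1 +
        K₂ * Δ * msD A₃ A₄ 2 +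
        K₁ * ((uRowTwoConst A A₃ ((bandBounds (show (-4 : ℝ) < -1.1 by norm_num) (show (-1.1 : ℝ) ≤ -0.1 by norm_num) (show (-0.1 : ℝ) < 0 by norm_num)).Dtmin - 2 * A) +
              1 / ((bandBounds (show (-4 : ℝ) < -1.1 by norm_num) (show (-1.1 : ℝ) ≤ -0.1 by norm_num) (show (-0.1 : ℝ) < 0 by norm_num)).Dtmin - 2 * A) +
              2 * (radialRowOneConst A ((bandBounds (show (-4 : ℝ) < -1.1 by norm_num) (show (-1.1 : ℝ) ≤ -0.1 by norm_num) (show (-0.1 : ℝ) < 0 by norm_num)).Dtmin - 2 * A) -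
                1 / ((bandBounds (show (-4 : ℝ) < -1.1 by norm_num) (show (-1.1 : ℝ) ≤ -0.1 by norm_num) (show (-0.1 : ℝ) < 0 by norm_num)).Dtmin - 2 * A))) * |ρ| +
            msD A₃ A₄ 3 * ω)) <
      9 / 400 * (bandBounds (show (-4 : ℝ) < -1.1 by norm_num) (show (-1.1 : ℝ) ≤ -0.1 by norm_num) (show (-0.1 : ℝ) < 0 by norm_num)).umin ^ 2)
    {m : ℝ → ℝ} (hcont : ContinuousOn m (Icc α β))
    (hmle : ∀ ϑ ∈ Icc α β, ∀ φ ∈ Icc φa φb, m ϑ ≤ frameLevel μ K (c + (levelPoint μ K ρ (ϑ + θ) - levelPoint μ K 0 (φ + θ))))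
    (hmex : ∀ ϑ ∈ Icc α β, ∃ φ ∈ Icc φa φb, m ϑ = frameLevel μ K (c + (levelPoint μ K ρ (ϑ + θ) - levelPoint μ K 0 (φ + θ))))
    {F Rm : ℝ → ℝ} {lo A' P B : ℝ} (hlo' : 0 < lo) (hA' : 0 ≤ A') (hP : 0 ≤ P) (hB : 0 ≤ B)
    (hF0 : ∀ ϑ ∈ Icc α β, 0 ≤ F ϑ) (hR0 : ∀ ϑ ∈ Icc α β, 0 ≤ Rm ϑ) (hRi : IntervalIntegrable Rm volume α β)
    (hpre : ∀ ϑ ∈ Ioo α β, 0 < m ϑ → F ϑ ≤ A' * (lo * ((max |m ϑ| lo)⁻¹ * (Real.sqrt (max |m ϑ| lo))⁻¹)) + B + Rm ϑ)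
    (hpost : ∀ ϑ ∈ Ioo α β, m ϑ < 0 → F ϑ ≤ P * (Real.sqrt |m ϑ|)⁻¹ + B + Rm ϑ) :
    ∫ ϑ in α..β, F ϑ ≤ (8 * A' + 4 * P) / Real.sqrt ((9 / 400 * (bandBounds (show (-4 : ℝ) < -1.1 by norm_num) (show (-1.1 : ℝ) ≤ -0.1 by norm_num) (show (-0.1 : ℝ) < 0 by norm_num)).umin ^ 2 -
        2 * (2 * K₃ * Δ * msD A₃ A₄ 1 ^ 2 +
          4 * K₂ * (radialRowOneConst A ((bandBounds (show (-4 : ℝ) < -1.1 by norm_num) (show (-1.1 : ℝ) ≤ -0.1 by norm_num) (show (-0.1 : ℝ) < 0 by norm_num)).Dtmin - 2 * A) * |ρ| +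
            msD A₃ A₄ 2 * ω) * msD A₃ A₄ 1 +
          K₂ * Δ * msD A₃ A₄ 2 +
          K₁ * ((uRowTwoConst A A₃ ((bandBounds (show (-4 : ℝ) < -1.1 by norm_num) (show (-1.1 : ℝ) ≤ -0.1 by norm_num) (show (-0.1 : ℝ) < 0 by norm_num)).Dtmin - 2 * A) +
                1 / ((bandBounds (show (-4 : ℝ) < -1.1 by norm_num) (show (-1.1 : ℝ) ≤ -0.1 by norm_num) (show (-0.1 : ℝ) < 0 by norm_num)).Dtmin - 2 * A) +
                2 * (radialRowOneConst A ((bandBounds (show (-4 : ℝ) < -1.1 by norm_num) (show (-1.1 : ℝ) ≤ -0.1 by norm_num) (show (-0.1 : ℝ) < 0 by norm_num)).Dtmin - 2 * A) -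
                  1 / ((bandBounds (show (-4 : ℝ) < -1.1 by norm_num) (show (-1.1 : ℝ) ≤ -0.1 by norm_num) (show (-0.1 : ℝ) < 0 by norm_num)).Dtmin - 2 * A))) * |ρ| +
              msD A₃ A₄ 3 * ω))) / 2) +
      B * (β - α) + ∫ ϑ in α..β, Rm ϑ := by
  set B₀ := bandBounds (show (-4 : ℝ) < -1.1 by norm_num) (show (-1.1 : ℝ) ≤ -0.1 by norm_num) (show (-0.1 : ℝ) < 0 by norm_num) with hB₀
  set ε : ℝ := 2 * K₃ * Δ * msD A₃ A₄ 1 ^ 2 +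
      4 * K₂ * (radialRowOneConst A (B₀.Dtmin - 2 * A) * |ρ| + msD A₃ A₄ 2 * ω) * msD A₃ A₄ 1 + K₂ * Δ * msD A₃ A₄ 2 +
      K₁ * ((uRowTwoConst A A₃ (B₀.Dtmin - 2 * A) + 1 / (B₀.Dtmin - 2 * A) + 2 * (radialRowOneConst A (B₀.Dtmin - 2 * A) - 1 / (B₀.Dtmin - 2 * A))) * |ρ| +
        msD A₃ A₄ 3 * ω) with hε
  set κ₀ : ℝ := 9 / 400 * B₀.umin ^ 2 - 2 * ε with hκ₀
  have hκ₀pos : 0 < κ₀ := by rw [hκ₀]; linarith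
  have hbudget' : ε ≤ 3 / 2 * (3 / 200 * B₀.umin ^ 2) := by
    have hε0 : 9 / 400 * B₀.umin ^ 2 - 2 * ε > 0 := hκ₀pos
    -- `ε < (9/800)u² ≤ (9/400)u²`
    nlinarith [sq_nonneg B₀.umin]
  -- (i) joint strong convexity on the box
  have hS : Convex ℝ (Icc α β ×ˢ Icc φa φb) := (convex_Icc α β).prod (convex_Icc φa φb)
  have hconv := convexOn_partnerBand_antipodal_sub_sq hA hA20 hd hr hlo hhi hA₃ hA₄ hK₁ hK₂ hK₃ hF hρ c θ ψ hS hΔ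
    (fun x hx => hω₁ x.1 hx.1) (fun x hx => hω₂ x.2 hx.2) hbudget'
  -- (ii) the attained minimum inherits the modulus
  have hm : ConvexOn ℝ (Icc α β) (fun ϑ => m ϑ - κ₀ / 2 * ϑ ^ 2) :=
    convexOn_min_sub_sq_of_exists (g := fun ϑ φ => frameLevel μ K (c + (levelPoint μ K ρ (ϑ + θ) - levelPoint μ K 0 (φ + θ))))
      hconv (convex_Icc α β) (convex_Icc φa φb) hmle hmex
  -- (iii) the dispatcher
  exact intervalIntegral_caustic_dispatch_remainder_le hαβ hκ₀pos hlo' hA' hP hB hm hcont hF0 hR0 hRi hpre hpost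

/-- **THE SAME WITH THE CANONICAL OFFSET `δ₀(ϑ) = inf_{φ ∈ [φa,φb]} e_K(c + Φ(ρ,ϑ+θ) − Φ(0,φ+θ))`** (nonempty φ-window): continuity in `ϑ`
(`IsCompact.continuous_sInf`), attainment and minimality (`IsCompact.exists_sInf_image_eq_and_le`) are discharged here, so the caller supplies only `FrameOK`, the window
geometry, the budget and the two laws keyed to the sign of this infimum. -/
theorem intervalIntegral_caustic_dispatch_partnerBand_sInf_le {R : RenConsts} {U : ℝ} {N : ℕ} (hF : FrameOK R U N μ K) {ρ : ℝ} (hρ : |ρ| < r)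
    (c : Momentum) (θ ψ : ℝ) {α β φa φb : ℝ} (hαβ : α ≤ β) (hφ : φa ≤ φb) {Δ ω : ℝ}
    (hΔ : ∀ x ∈ Icc α β ×ˢ Icc φa φb, ‖c + (levelPoint μ K ρ (x.1 + θ) - levelPoint μ K 0 (x.2 + θ)) - levelPoint μ K 0 ψ‖ ≤ Δ)
    (hω₁ : ∀ ϑ ∈ Icc α β, |ϑ + θ - (ψ + π)| ≤ ω) (hω₂ : ∀ φ ∈ Icc φa φb, |φ + θ - ψ| ≤ ω)
    (hbudget : 2 * (2 * K₃ * Δ * msD A₃ A₄ 1 ^ 2 +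
        4 * K₂ * (radialRowOneConst A ((bandBounds (show (-4 : ℝ) < -1.1 by norm_num) (show (-1.1 : ℝ) ≤ -0.1 by norm_num) (show (-0.1 : ℝ) < 0 by norm_num)).Dtmin - 2 * A) * |ρ| +
          msD A₃ A₄ 2 * ω) * msD A₃ A₄ 1 +
        K₂ * Δ * msD A₃ A₄ 2 +
        K₁ * ((uRowTwoConst A A₃ ((bandBounds (show (-4 : ℝ) < -1.1 by norm_num) (show (-1.1 : ℝ) ≤ -0.1 by norm_num) (show (-0.1 : ℝ) < 0 by norm_num)).Dtmin - 2 * A) +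
              1 / ((bandBounds (show (-4 : ℝ) < -1.1 by norm_num) (show (-1.1 : ℝ) ≤ -0.1 by norm_num) (show (-0.1 : ℝ) < 0 by norm_num)).Dtmin - 2 * A) +
              2 * (radialRowOneConst A ((bandBounds (show (-4 : ℝ) < -1.1 by norm_num) (show (-1.1 : ℝ) ≤ -0.1 by norm_num) (show (-0.1 : ℝ) < 0 by norm_num)).Dtmin - 2 * A) -
                1 / ((bandBounds (show (-4 : ℝ) < -1.1 by norm_num) (show (-1.1 : ℝ) ≤ -0.1 by norm_num) (show (-0.1 : ℝ) < 0 by norm_num)).Dtmin - 2 * A))) * |ρ| +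
            msD A₃ A₄ 3 * ω)) <
      9 / 400 * (bandBounds (show (-4 : ℝ) < -1.1 by norm_num) (show (-1.1 : ℝ) ≤ -0.1 by norm_num) (show (-0.1 : ℝ) < 0 by norm_num)).umin ^ 2)
    {F Rm : ℝ → ℝ} {lo A' P B : ℝ} (hlo' : 0 < lo) (hA' : 0 ≤ A') (hP : 0 ≤ P) (hB : 0 ≤ B)
    (hF0 : ∀ ϑ ∈ Icc α β, 0 ≤ F ϑ) (hR0 : ∀ ϑ ∈ Icc α β, 0 ≤ Rm ϑ) (hRi : IntervalIntegrable Rm volume α β)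
    (hpre : ∀ ϑ ∈ Ioo α β, 0 < sInf ((fun φ => frameLevel μ K (c + (levelPoint μ K ρ (ϑ + θ) - levelPoint μ K 0 (φ + θ)))) '' Icc φa φb) →
      F ϑ ≤ A' * (lo * ((max |sInf ((fun φ => frameLevel μ K (c + (levelPoint μ K ρ (ϑ + θ) - levelPoint μ K 0 (φ + θ)))) '' Icc φa φb)| lo)⁻¹ *
        (Real.sqrt (max |sInf ((fun φ => frameLevel μ K (c + (levelPoint μ K ρ (ϑ + θ) - levelPoint μ K 0 (φ + θ)))) '' Icc φa φb)| lo))⁻¹)) + B + Rm ϑ)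
    (hpost : ∀ ϑ ∈ Ioo α β, sInf ((fun φ => frameLevel μ K (c + (levelPoint μ K ρ (ϑ + θ) - levelPoint μ K 0 (φ + θ)))) '' Icc φa φb) < 0 →
      F ϑ ≤ P * (Real.sqrt |sInf ((fun φ => frameLevel μ K (c + (levelPoint μ K ρ (ϑ + θ) - levelPoint μ K 0 (φ + θ)))) '' Icc φa φb)|)⁻¹ + B + Rm ϑ) :
    ∫ ϑ in α..β, F ϑ ≤ (8 * A' + 4 * P) / Real.sqrt ((9 / 400 * (bandBounds (show (-4 : ℝ) < -1.1 by norm_num) (show (-1.1 : ℝ) ≤ -0.1 by norm_num) (show (-0.1 : ℝ) < 0 by norm_num)).umin ^ 2 -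
        2 * (2 * K₃ * Δ * msD A₃ A₄ 1 ^ 2 +
          4 * K₂ * (radialRowOneConst A ((bandBounds (show (-4 : ℝ) < -1.1 by norm_num) (show (-1.1 : ℝ) ≤ -0.1 by norm_num) (show (-0.1 : ℝ) < 0 by norm_num)).Dtmin - 2 * A) * |ρ| +
            msD A₃ A₄ 2 * ω) * msD A₃ A₄ 1 +
          K₂ * Δ * msD A₃ A₄ 2 +
          K₁ * ((uRowTwoConst A A₃ ((bandBounds (show (-4 : ℝ) < -1.1 by norm_num) (show (-1.1 : ℝ) ≤ -0.1 by norm_num) (show (-0.1 : ℝ) < 0 by norm_num)).Dtmin - 2 * A) +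
                1 / ((bandBounds (show (-4 : ℝ) < -1.1 by norm_num) (show (-1.1 : ℝ) ≤ -0.1 by norm_num) (show (-0.1 : ℝ) < 0 by norm_num)).Dtmin - 2 * A) +
                2 * (radialRowOneConst A ((bandBounds (show (-4 : ℝ) < -1.1 by norm_num) (show (-1.1 : ℝ) ≤ -0.1 by norm_num) (show (-0.1 : ℝ) < 0 by norm_num)).Dtmin - 2 * A) -
                  1 / ((bandBounds (show (-4 : ℝ) < -1.1 by norm_num) (show (-1.1 : ℝ) ≤ -0.1 by norm_num) (show (-0.1 : ℝ) < 0 by norm_num)).Dtmin - 2 * A))) * |ρ| +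
              msD A₃ A₄ 3 * ω))) / 2) +
      B * (β - α) + ∫ ϑ in α..β, Rm ϑ := by
  set B₀ := bandBounds (show (-4 : ℝ) < -1.1 by norm_num) (show (-1.1 : ℝ) ≤ -0.1 by norm_num) (show (-0.1 : ℝ) < 0 by norm_num) with hB₀
  have hADt : 2 * A < B₀.Dtmin := by have := klCurveD_pos; linarith
  have h0 : |(0 : ℝ)| < r := by simpa using hr
  -- the family is jointly continuous
  set g : ℝ → ℝ → ℝ := fun ϑ φ => frameLevel μ K (c + (levelPoint μ K ρ (ϑ + θ) - levelPoint μ K 0 (φ + θ))) with hg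
  have hcρ : Continuous (levelPoint μ K ρ) := (contDiff_levelPoint_angle B₀ hA hADt hlo hhi hρ (m := 0)).continuous
  have hc0 : Continuous (levelPoint μ K 0) := (contDiff_levelPoint_angle B₀ hA hADt hlo hhi h0 (m := 0)).continuous
  have hjoint : Continuous ↿g := by
    have h1 : Continuous fun p : ℝ × ℝ => c + (levelPoint μ K ρ (p.1 + θ) - levelPoint μ K 0 (p.2 + θ)) :=
      continuous_const.add ((hcρ.comp (continuous_fst.add continuous_const)).sub (hc0.comp (continuous_snd.add continuous_const)))
    exact (EngineV8.contDiff_frameLevel μ K (n := 0)).continuous.comp h1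
  have hcont : ContinuousOn (fun ϑ => sInf (g ϑ '' Icc φa φb)) (Icc α β) := ((isCompact_Icc).continuous_sInf hjoint).continuousOn
  have hslice : ∀ ϑ : ℝ, ContinuousOn (g ϑ) (Icc φa φb) := fun ϑ =>
    ((EngineV8.contDiff_frameLevel μ K (n := 0)).continuous.comp
      (continuous_const.add (continuous_const.sub (hc0.comp (continuous_id.add continuous_const))))).continuousOn
  have hmin : ∀ ϑ ∈ Icc α β, (∀ φ ∈ Icc φa φb, sInf (g ϑ '' Icc φa φb) ≤ g ϑ φ) ∧ ∃ φ ∈ Icc φa φb, sInf (g ϑ '' Icc φa φb) = g ϑ φ := fun ϑ _ => by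
    obtain ⟨x, hx, hxeq, hxle⟩ := isCompact_Icc.exists_sInf_image_eq_and_le (nonempty_Icc.2 hφ) (hslice ϑ)
    exact ⟨fun φ hφ' => hxeq ▸ hxle φ hφ', x, hx, hxeq⟩
  exact intervalIntegral_caustic_dispatch_partnerBand_le hA hA20 hd hr hlo hhi hA₃ hA₄ hK₁ hK₂ hK₃ hF hρ c θ ψ hαβ hΔ hω₁ hω₂ hbudget hcont
    (fun ϑ hϑ => (hmin ϑ hϑ).1) (fun ϑ hϑ => (hmin ϑ hϑ).2) hlo' hA' hP hB hF0 hR0 hRi hpre hpost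

end Sizes

end Summit.HubbardSuperconductivity.HubbardSuperconductivity.Theorems.C4a

end
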